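import Mathlib
import Summits.NavierStokesRegularity.NavierStokesRegularity.Theorems.ScenarioCensusPeriodicSlabBounds
import HarnessLib

/-!
# Census row S6 (bounded helical steady flows, any period–Reynolds number): slab tools —
# translation invariance (Bochner form), signed vertical averaging, and the Poincaré–Wirtinger
# inequality for zero-mean periodic scalars

Support file for the scenario census of `NavierStokesRegularity` (cell `pub/ns-census`, block S,
row S6 = Han–Wang–Xie, arXiv:2312.10382 = Sci. China Math. 2025, Thm 1.1: a bounded smooth
helically symmetric steady Navier–Stokes flow on `ℝ³` is an axial constant `C e₃`; tree FACT
`Literature.Analysis.FluidPDE.HanWangXie2023_helical_liouville`). The tree proof of row S6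
(`…HelicalSlabLiouville`) runs the Saint-Venant argument of the printed proof (§3: "Poincaré
inequality (A122)" for the radial velocity, whose vertical period means vanish by the helical
identities) on top of the period-slab machinery of row S7d (`…PeriodicSlab*`). This file adds the
three measure-theoretic tools that the S7d chain did not need:

* `setIntegral_zSlab_comp_add_smul_eZ` — Bochner form of `…PeriodicSlabTools`'
  `setLIntegral_zSlab_comp_add_smul_eZ`: the integral over one period slab of an axially periodic
  function is invariant under ALL axial translations;
* `setIntegral_zSlab_mul_verticalIntegral_real` — SIGNED vertical averaging (Fubini):
  `∫_{slab} g(x) (∫₀ᴸ f(x + s e₃) ds) dx = L ∫_{slab} g f` for a bounded measurable `z`-independent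
  weight `g` vanishing off a cylinder and a continuous periodic `f` (the `ℝ≥0∞` version for
  nonnegative data is `setLIntegral_zSlab_mul_verticalIntegral`); in particular such integrals
  vanish when `f` has zero vertical period means (`setIntegral_zSlab_mul_eq_zero_of_verticalMean`);
* `slab_poincare_of_verticalMean_eq_zero` — the Poincaré–Wirtinger inequality
  `(2π/L)² ∫_{slab} g f² ≤ ∫_{slab} g (∂₃f)²` for a `C¹` axially periodic SCALAR `f` whose vertical
  period means vanish, under a `z`-independent weight (the S7d file `slab_wirtinger` is the case
  `f = ∂₃V`); sharp constant via `Literature.Analysis.FluidPDE.wirtinger_interval_real`.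

No summit statement and no census row is proved in this file.

## References

* J. Han, Y. Wang, C. Xie, arXiv:2312.10382 (2023), §3, proof of Lemma 3.1 / Thm 1.1 ((A117),
  (A122): zero vertical means and the Poincaré inequality for `u^r`). [HanWangXie2023]
* J. Bang, C. Gui, Y. Wang, C. Xie, J. Fluid Mech. 1005 (2025) A6 = arXiv:2205.13259, §5.
  [BangGuiWangXie2025]
-/

-- the summit and its single problem share the name (D-0017 nested layout)
set_option linter.dupNamespace false

noncomputable section

open MeasureTheory Set Function Filter
open scoped Topology ENNReal NNReal InnerProductSpace

namespace Summit.NavierStokesRegularity.NavierStokesRegularity.Theorems.ScenarioCensus.HelicalSlab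

open Literature.Analysis Literature.Analysis.FluidPDE
open Summit.NavierStokesRegularity.NavierStokesRegularity.Theorems.ScenarioCensus.PeriodicSlab

/-! ### Translation invariance of slab integrals (Bochner form) -/

/-- **All axial translates have the same integral over one period** (Bochner form). For a real
axially `L`-periodic `Q` (`L > 0`), a.e.-strongly measurable, with `Q` and its translate
`Q(· + s e₃)` integrable on the period slab: `∫_{zSlab L 0} Q(x + s e₃) dx = ∫_{zSlab L 0} Q`. -/
theorem setIntegral_zSlab_comp_add_smul_eZ {L : ℝ} (hL : 0 < L)
    {Q : EuclideanSpace ℝ (Fin 3) → ℝ} (hQper : IsAxiallyPeriodic L Q)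
    (hQm : AEStronglyMeasurable Q volume) (hQi : IntegrableOn Q (zSlab L 0) volume) (s : ℝ)
    (hQsi : IntegrableOn (fun x => Q (x + s • eZ)) (zSlab L 0) volume) :
    ∫ x in zSlab L 0, Q (x + s • eZ) = ∫ x in zSlab L 0, Q x := by
  have hQs : IsAxiallyPeriodic L (fun x => Q (x + s • eZ)) := isAxiallyPeriodic_comp_add_smul_eZ hQper s
  have hQsm : AEStronglyMeasurable (fun x => Q (x + s • eZ)) volume :=
    hQm.comp_quasiMeasurePreserving (measurePreserving_add_right volume (s • eZ)).quasiMeasurePreserving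
  -- the translate, integrated against the window
  rw [← integral_mul_periodicWindow_sq hL hQs hQsm hQsi]
  -- substitute `x ↦ x - s e₃` (translation invariance of Lebesgue measure)
  have h1 : ∫ x, Q (x + s • eZ) * periodicWindow L (x 2) ^ 2 =
      ∫ x, Q x * periodicWindow L (x 2 - s) ^ 2 := by
    rw [← integral_add_right_eq_self
      (fun x : EuclideanSpace ℝ (Fin 3) => Q x * periodicWindow L (x 2 - s) ^ 2) (s • eZ)]
    refine integral_congr_ae (Eventually.of_forall fun x => ?_)
    simp only [apply_two_add_smul_eZ, add_sub_cancel_right]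
  rw [h1]
  -- the shifted window still has translates summing to `1`
  have hWm : Measurable fun z : ℝ => periodicWindow L (z - s) ^ 2 :=
    (((contDiff_periodicWindow L (n := 0)).continuous.comp (continuous_id.sub continuous_const)).pow 2).measurable
  have h2 := hQper.integral_mul_comp_apply_two_eq_const_mul hL hQm hQi hWm
    (A := 2 * L + |s|) (B := 1) (c := 1)
    (fun z hz => by
      have hz' : periodicWindow L (z - s) ≠ 0 := fun h => hz (by rw [h]; ring)
      have hm := mem_Ioo_of_periodicWindow_ne_zero hL hz'
      constructor
      · linarith [hm.1, neg_abs_le s, hL]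
      · linarith [hm.2, le_abs_self s])
    (fun z => by
      rw [abs_of_nonneg (sq_nonneg _), sq_le_one_iff_abs_le_one]
      exact abs_periodicWindow_le_one L _)
    (fun z => by
      have e : (fun k : ℤ => periodicWindow L (z + (k : ℝ) * L - s) ^ 2) =
          fun k : ℤ => periodicWindow L ((z - s) + (k : ℝ) * L) ^ 2 := by
        funext k; ring_nf
      rw [e, tsum_periodicWindow_sq hL (z - s)])
  rw [h2, one_mul]

/-- A point of the period slab inside the cylinder `{r < ρ}`, translated by `s e₃` with
`s ∈ [0, L]`, lies in the closed ball of radius `|ρ| + 2L`. -/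
theorem norm_add_smul_eZ_le {L ρ : ℝ} (hL : 0 < L) {x : EuclideanSpace ℝ (Fin 3)}
    (hx : x ∈ zSlab L 0) (hr : cylRadius x < ρ) {s : ℝ} (hs : s ∈ Icc (0 : ℝ) L) :
    ‖x + s • eZ‖ ≤ |ρ| + 2 * L := by
  have h1 := norm_le_of_mem_zSlab_of_cylRadius_lt hL hx hr
  have h2 : ‖s • (eZ : EuclideanSpace ℝ (Fin 3))‖ ≤ L := by
    rw [norm_smul, Real.norm_of_nonneg hs.1]
    have : ‖(eZ : EuclideanSpace ℝ (Fin 3))‖ = 1 := by simp [eZ]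
    rw [this, mul_one]; exact hs.2
  calc ‖x + s • eZ‖ ≤ ‖x‖ + ‖s • (eZ : EuclideanSpace ℝ (Fin 3))‖ := norm_add_le _ _
    _ ≤ |ρ| + 2 * L := by linarith

/-! ### Signed vertical averaging -/

/-- **Signed vertical averaging on one period** (Fubini). For a measurable `z`-independent
weight `g` with `|g| ≤ G`, vanishing off a cylinder, and a continuous axially `L`-periodic `f`
(`L > 0`): `∫_{slab} g(x) (∫₀ᴸ f(x + s e₃) ds) dx = L ∫_{slab} g f`. (Swap the integrals; the
inner slab integral of `x ↦ g(x) f(x + s e₃) = (g f)(x + s e₃)` does not depend on `s` by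
`setIntegral_zSlab_comp_add_smul_eZ`.) -/
theorem setIntegral_zSlab_mul_verticalIntegral_real {L : ℝ} (hL : 0 < L)
    {g : EuclideanSpace ℝ (Fin 3) → ℝ} (hgm : Measurable g)
    (hgz : ∀ (x : EuclideanSpace ℝ (Fin 3)) (s : ℝ), g (x + s • eZ) = g x)
    {G : ℝ} (hgG : ∀ x, |g x| ≤ G) {ρ : ℝ} (hgρ : ∀ x, ρ ≤ cylRadius x → g x = 0)
    {f : EuclideanSpace ℝ (Fin 3) → ℝ} (hfc : Continuous f) (hfper : IsAxiallyPeriodic L f) :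
    ∫ x in zSlab L 0, g x * ∫ s in (0 : ℝ)..L, f (x + s • eZ) =
      L * ∫ x in zSlab L 0, g x * f x := by
  set S : Set (EuclideanSpace ℝ (Fin 3)) := zSlab L 0 with hS
  set F : EuclideanSpace ℝ (Fin 3) → ℝ → ℝ := fun x s => g x * f (x + s • eZ) with hF
  have hG0 : 0 ≤ G := (abs_nonneg _).trans (hgG 0)
  have hcyl : ∀ (x : EuclideanSpace ℝ (Fin 3)) (s : ℝ), cylRadius (x + s • eZ) = cylRadius x :=
    fun x s => by simp [cylRadius, eZ]
  -- a bound for `f` on the relevant compact set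
  obtain ⟨B, hB⟩ := (isCompact_closedBall (0 : EuclideanSpace ℝ (Fin 3)) (|ρ| + 2 * L)).exists_bound_of_continuousOn
    hfc.continuousOn
  have hB0 : 0 ≤ B := (norm_nonneg _).trans (hB 0 (Metric.mem_closedBall_self (by positivity)))
  -- (a) the left-hand side as an iterated integral over `S × Ioc 0 L`
  have hlhs : ∫ x in S, g x * ∫ s in (0 : ℝ)..L, f (x + s • eZ) =
      ∫ x in S, ∫ s in Ioc (0 : ℝ) L, F x s := by
    refine setIntegral_congr_fun (measurableSet_zSlab L 0) fun x _ => ?_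
    simp only [hF]
    rw [intervalIntegral.integral_of_le hL.le, ← integral_const_mul]
  rw [hlhs]
  -- (b) integrability on the product
  have hFm : AEStronglyMeasurable (uncurry F)
      ((volume.restrict S).prod (volume.restrict (Ioc (0 : ℝ) L))) := by
    refine (Measurable.aestronglyMeasurable ?_)
    exact (hgm.comp measurable_fst).mul
      (hfc.measurable.comp (measurable_fst.add (measurable_snd.smul measurable_const)))
  have hFint : Integrable (uncurry F) ((volume.restrict S).prod (volume.restrict (Ioc (0 : ℝ) L))) := by
    rw [integrable_prod_iff hFm]
    constructor
    · refine Eventually.of_forall fun x => ?_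
      show Integrable (fun s => g x * f (x + s • eZ)) (volume.restrict (Ioc 0 L))
      have hc : Continuous fun s : ℝ => g x * f (x + s • eZ) :=
        continuous_const.mul (hfc.comp (continuous_const.add (continuous_id.smul continuous_const)))
      exact (hc.integrableOn_Icc (a := 0) (b := L)).mono_set Ioc_subset_Icc_self
    · -- `x ↦ ∫ |F x s| ds` is bounded by `G L B` on the slab part of the cylinder and vanishes off it
      have hnorm : ∀ x, (∫ s in Ioc (0 : ℝ) L, ‖uncurry F (x, s)‖) =
          |g x| * ∫ s in Ioc (0 : ℝ) L, |f (x + s • eZ)| := fun x => by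
        rw [← integral_const_mul]
        refine integral_congr_ae (Eventually.of_forall fun s => ?_)
        simp only [hF, uncurry_apply_pair, norm_mul, Real.norm_eq_abs]
      simp_rw [hnorm]
      have hIc : Continuous fun x : EuclideanSpace ℝ (Fin 3) => ∫ s in Ioc (0 : ℝ) L, |f (x + s • eZ)| := by
        have h := intervalIntegral.continuous_parametric_intervalIntegral_of_continuous'
          (μ := volume) (f := fun (x : EuclideanSpace ℝ (Fin 3)) (s : ℝ) => |f (x + s • eZ)|)
          (by exact (hfc.comp (continuous_fst.add (continuous_snd.smul continuous_const))).abs) 0 L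
        refine h.congr fun x => ?_
        rw [intervalIntegral.integral_of_le hL.le]
      have hm : AEStronglyMeasurable
          (fun x : EuclideanSpace ℝ (Fin 3) => |g x| * ∫ s in Ioc (0 : ℝ) L, |f (x + s • eZ)|) volume :=
        ((continuous_abs.measurable.comp hgm).mul hIc.measurable).aestronglyMeasurable
      refine integrableOn_zSlab_of_bound hL hm (ρ := ρ) (fun x hx => by rw [hgρ x hx, abs_zero, zero_mul])
        (B := G * (L * B)) fun x hx => ?_
      rw [Real.norm_eq_abs, abs_mul, abs_abs]
      by_cases hxr : ρ ≤ cylRadius x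
      · rw [hgρ x hxr, abs_zero, zero_mul]; positivity
      · rw [not_le] at hxr
        have hint : |(∫ s in Ioc (0 : ℝ) L, |f (x + s • eZ)|)| ≤ L * B := by
          rw [abs_of_nonneg (integral_nonneg fun s => abs_nonneg _)]
          have hle : ∫ s in Ioc (0 : ℝ) L, |f (x + s • eZ)| ≤ ∫ s in Ioc (0 : ℝ) L, B := by
            refine setIntegral_mono_on ?_ (integrableOn_const (by simp)) measurableSet_Ioc fun s hs => ?_
            · have hc : Continuous fun s : ℝ => |f (x + s • eZ)| :=
                (hfc.comp (continuous_const.add (continuous_id.smul continuous_const))).abs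
              exact (hc.integrableOn_Icc (a := 0) (b := L)).mono_set Ioc_subset_Icc_self
            · rw [← Real.norm_eq_abs]
              refine hB _ (Metric.mem_closedBall.2 ?_)
              rw [dist_zero_right]
              -- `x` need not lie in the slab here; bound directly through `‖x‖ ≤ |ρ| + L`?
              -- we only know `‖x‖ ≤ |ρ| + L` for slab points; use the hypothesis `hx` instead
              calc ‖x + s • eZ‖ ≤ ‖x‖ + ‖s • (eZ : EuclideanSpace ℝ (Fin 3))‖ := norm_add_le _ _
                _ ≤ (|ρ| + L) + L := by
                    have h1 : ‖s • (eZ : EuclideanSpace ℝ (Fin 3))‖ ≤ L := by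
                      rw [norm_smul, Real.norm_of_nonneg hs.1.le]
                      have : ‖(eZ : EuclideanSpace ℝ (Fin 3))‖ = 1 := by simp [eZ]
                      rw [this, mul_one]; exact hs.2
                    linarith [hx]
                _ = |ρ| + 2 * L := by ring
          calc ∫ s in Ioc (0 : ℝ) L, |f (x + s • eZ)| ≤ ∫ s in Ioc (0 : ℝ) L, B := hle
            _ = L * B := by rw [setIntegral_const, Real.volume_real_Ioc_of_le hL.le, sub_zero, smul_eq_mul]
        exact mul_le_mul (hgG x) hint (abs_nonneg _) hG0
  -- (c) swap
  rw [integral_integral_swap hFint]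
  -- (d) the inner slab integral does not depend on `s`
  set Q : EuclideanSpace ℝ (Fin 3) → ℝ := fun x => g x * f x with hQ
  have hQper : IsAxiallyPeriodic L Q := fun x => by
    simp only [hQ]
    rw [hfper x]
    have : g (x + L • EuclideanSpace.single 2 (1 : ℝ)) = g x := hgz x L
    rw [this]
  have hQm : AEStronglyMeasurable Q volume := (hgm.mul hfc.measurable).aestronglyMeasurable
  have hballB : ∀ y : EuclideanSpace ℝ (Fin 3), ‖y‖ ≤ |ρ| + 2 * L → |f y| ≤ B := fun y hy => by
    rw [← Real.norm_eq_abs]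
    exact hB y (Metric.mem_closedBall.2 (by rwa [dist_zero_right]))
  have hQi : IntegrableOn Q S volume := by
    refine integrableOn_zSlab_of_bound hL hQm (ρ := ρ) (fun x hx => by simp only [hQ, hgρ x hx, zero_mul])
      (B := G * B) fun x hx => ?_
    simp only [hQ, Real.norm_eq_abs, abs_mul]
    exact mul_le_mul (hgG x) (hballB x (by linarith [hx, hL])) (abs_nonneg _) hG0
  have hQsi : ∀ s ∈ Icc (0 : ℝ) L, IntegrableOn (fun x => Q (x + s • eZ)) S volume := by
    intro s hs
    have hm : AEStronglyMeasurable (fun x => Q (x + s • eZ)) volume :=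
      hQm.comp_quasiMeasurePreserving (measurePreserving_add_right volume (s • eZ)).quasiMeasurePreserving
    refine integrableOn_zSlab_of_bound hL hm (ρ := ρ)
      (fun x hx => by simp only [hQ]; rw [hgz x s, hgρ x hx, zero_mul]) (B := G * B) fun x hx => ?_
    simp only [hQ, Real.norm_eq_abs, abs_mul, hgz x s]
    refine mul_le_mul (hgG x) (hballB _ ?_) (abs_nonneg _) hG0
    calc ‖x + s • eZ‖ ≤ ‖x‖ + ‖s • (eZ : EuclideanSpace ℝ (Fin 3))‖ := norm_add_le _ _
      _ ≤ (|ρ| + L) + L := by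
          have h1 : ‖s • (eZ : EuclideanSpace ℝ (Fin 3))‖ ≤ L := by
            rw [norm_smul, Real.norm_of_nonneg hs.1]
            have : ‖(eZ : EuclideanSpace ℝ (Fin 3))‖ = 1 := by simp [eZ]
            rw [this, mul_one]; exact hs.2
          linarith [hx]
      _ = |ρ| + 2 * L := by ring
  have hinner : ∀ s ∈ Ioc (0 : ℝ) L, ∫ x in S, F x s = ∫ x in S, Q x := by
    intro s hs
    have e : (fun x => F x s) = fun x => Q (x + s • eZ) := by
      funext x; simp only [hF, hQ, hgz x s]
    rw [e]
    exact setIntegral_zSlab_comp_add_smul_eZ hL hQper hQm hQi s (hQsi s (Ioc_subset_Icc_self hs))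
  rw [setIntegral_congr_fun measurableSet_Ioc hinner, setIntegral_const, Real.volume_real_Ioc_of_le hL.le,
    sub_zero, smul_eq_mul]

/-- **Integrals of `z`-independent weights against functions with zero vertical period means
vanish**: with `g`, `f` as in `setIntegral_zSlab_mul_verticalIntegral_real` and
`∫₀ᴸ f(x + s e₃) ds = 0` for every `x`, `∫_{slab} g f = 0`. -/
theorem setIntegral_zSlab_mul_eq_zero_of_verticalMean {L : ℝ} (hL : 0 < L)
    {g : EuclideanSpace ℝ (Fin 3) → ℝ} (hgm : Measurable g)
    (hgz : ∀ (x : EuclideanSpace ℝ (Fin 3)) (s : ℝ), g (x + s • eZ) = g x)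
    {G : ℝ} (hgG : ∀ x, |g x| ≤ G) {ρ : ℝ} (hgρ : ∀ x, ρ ≤ cylRadius x → g x = 0)
    {f : EuclideanSpace ℝ (Fin 3) → ℝ} (hfc : Continuous f) (hfper : IsAxiallyPeriodic L f)
    (hmean : ∀ x, ∫ s in (0 : ℝ)..L, f (x + s • eZ) = 0) :
    ∫ x in zSlab L 0, g x * f x = 0 := by
  have h := setIntegral_zSlab_mul_verticalIntegral_real hL hgm hgz hgG hgρ hfc hfper
  simp_rw [hmean, mul_zero, integral_zero] at h
  have : L * ∫ x in zSlab L 0, g x * f x = 0 := h.symm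
  exact (mul_eq_zero.1 this).resolve_left hL.ne'

/-! ### The Poincaré–Wirtinger inequality for zero-mean periodic scalars -/

/-- **Vertical Poincaré–Wirtinger inequality for a scalar with zero period mean** (sharp
constant): for `f ∈ C¹` axially `L`-periodic (`L > 0`) and a base point `x` with
`∫₀ᴸ f(x + s e₃) ds = 0`, `(2π/L)² ∫₀ᴸ f(x + s e₃)² ds ≤ ∫₀ᴸ (∂₃f(x + s e₃))² ds`
(`Literature.Analysis.FluidPDE.wirtinger_interval_real`). This is the "Poincaré inequality
(A122)" of Han–Wang–Xie, §3, on one vertical period. -/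
theorem vertical_poincare_of_mean_eq_zero {L : ℝ} (hL : 0 < L) {f : EuclideanSpace ℝ (Fin 3) → ℝ}
    (hf : ContDiff ℝ 1 f) (hper : IsAxiallyPeriodic L f) (x : EuclideanSpace ℝ (Fin 3))
    (hmean : ∫ s in (0 : ℝ)..L, f (x + s • eZ) = 0) :
    (2 * Real.pi / L) ^ 2 * ∫ s in (0 : ℝ)..L, f (x + s • eZ) ^ 2 ≤
      ∫ s in (0 : ℝ)..L, (fderiv ℝ f (x + s • eZ) eZ) ^ 2 := by
  have hfd : Differentiable ℝ f := hf.differentiable one_ne_zero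
  have hDfc : Continuous (fderiv ℝ f) := hf.continuous_fderiv one_ne_zero
  have hℓc : Continuous fun s : ℝ => x + s • (eZ : EuclideanSpace ℝ (Fin 3)) :=
    continuous_const.add (continuous_id.smul continuous_const)
  have hc : ∀ s, HasDerivAt (fun σ : ℝ => f (x + σ • eZ)) (fderiv ℝ f (x + s • eZ) eZ) s :=
    fun s => hasDerivAt_comp_add_smul_eZ hfd x s
  have hc' : Continuous fun s : ℝ => fderiv ℝ f (x + s • eZ) eZ :=
    (hDfc.comp hℓc).clm_apply continuous_const
  have hcper : f (x + L • eZ) = f (x + (0 : ℝ) • eZ) := by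
    rw [zero_smul, add_zero]; exact isAxiallyPeriodic_add_smul_eZ hper x
  have h := wirtinger_interval_real hL hc hc' hcper hmean
  rwa [sub_zero] at h

/-- **The Poincaré–Wirtinger inequality on one period slab for a zero-mean periodic scalar, under
a `z`-independent weight** (sharp constant). Let `f ∈ C¹(ℝ³; ℝ)` be axially `L`-periodic
(`L > 0`) with `∫₀ᴸ f(x + s e₃) ds = 0` for every `x`, and let `g ≥ 0` be a bounded measurable
weight, independent of `x₃` and vanishing off a cylinder. Then
`(2π/L)² ∫_{zSlab L 0} g f² ≤ ∫_{zSlab L 0} g (∂₃f)²` (`∂₃f = Df(·) e₃`). (Vertical averaging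
`setLIntegral_zSlab_mul_verticalIntegral` + the pointwise inequality on vertical lines; the same
scheme as `slab_wirtinger` of the S7d chain.) -/
theorem slab_poincare_of_verticalMean_eq_zero {L : ℝ} (hL : 0 < L)
    {f : EuclideanSpace ℝ (Fin 3) → ℝ} (hf : ContDiff ℝ 1 f) (hper : IsAxiallyPeriodic L f)
    (hmean : ∀ x, ∫ s in (0 : ℝ)..L, f (x + s • eZ) = 0)
    {g : EuclideanSpace ℝ (Fin 3) → ℝ} (hgm : Measurable g)
    (hg0 : ∀ x, 0 ≤ g x) (hgz : ∀ (x : EuclideanSpace ℝ (Fin 3)) (s : ℝ), g (x + s • eZ) = g x)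
    {G : ℝ} (hgG : ∀ x, g x ≤ G) {ρ : ℝ} (hgρ : ∀ x, ρ ≤ cylRadius x → g x = 0) :
    (2 * Real.pi / L) ^ 2 * ∫ x in zSlab L 0, g x * f x ^ 2 ≤
      ∫ x in zSlab L 0, g x * (fderiv ℝ f x eZ) ^ 2 := by
  set df : EuclideanSpace ℝ (Fin 3) → ℝ := fun y => fderiv ℝ f y eZ with hdf
  have hfc : Continuous f := hf.continuous
  have hdfc : Continuous df := (hf.continuous_fderiv one_ne_zero).clm_apply continuous_const
  have hdfper : IsAxiallyPeriodic L df := fun y => by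
    show fderiv ℝ f (y + L • EuclideanSpace.single 2 1) eZ = fderiv ℝ f y eZ
    rw [isAxiallyPeriodic_fderiv hper y]
  -- the two densities
  set f₁ : EuclideanSpace ℝ (Fin 3) → ℝ := fun x => f x ^ 2 with hf₁
  set f₂ : EuclideanSpace ℝ (Fin 3) → ℝ := fun x => df x ^ 2 with hf₂
  have hf₁c : Continuous f₁ := hfc.pow 2
  have hf₂c : Continuous f₂ := hdfc.pow 2
  have hf₁per : IsAxiallyPeriodic L f₁ := fun x => by simp only [hf₁]; rw [hper x]
  have hf₂per : IsAxiallyPeriodic L f₂ := fun x => by simp only [hf₂]; rw [hdfper x]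
  -- vertical averaging
  have key₁ := setLIntegral_zSlab_mul_verticalIntegral hL hgm hg0 hgz hf₁c (fun x => sq_nonneg _) hf₁per
  have key₂ := setLIntegral_zSlab_mul_verticalIntegral hL hgm hg0 hgz hf₂c (fun x => sq_nonneg _) hf₂per
  -- pointwise vertical Poincaré–Wirtinger
  have hAB : ∀ x : EuclideanSpace ℝ (Fin 3),
      (2 * Real.pi / L) ^ 2 * (g x * ∫ s in (0 : ℝ)..L, f₁ (x + s • eZ)) ≤
        g x * ∫ s in (0 : ℝ)..L, f₂ (x + s • eZ) := by
    intro x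
    have h := vertical_poincare_of_mean_eq_zero hL hf hper x (hmean x)
    have hg := hg0 x
    calc (2 * Real.pi / L) ^ 2 * (g x * ∫ s in (0 : ℝ)..L, f₁ (x + s • eZ))
        = g x * ((2 * Real.pi / L) ^ 2 * ∫ s in (0 : ℝ)..L, f (x + s • eZ) ^ 2) := by
          simp only [hf₁]; ring
      _ ≤ g x * ∫ s in (0 : ℝ)..L, f₂ (x + s • eZ) := by
          simp only [hf₂, hdf]
          exact mul_le_mul_of_nonneg_left h hg
  -- the inequality between Lebesgue integrals
  set I₁ : ℝ≥0∞ := ∫⁻ x in zSlab L 0, ENNReal.ofReal (g x * f₁ x) with hI₁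
  set I₂ : ℝ≥0∞ := ∫⁻ x in zSlab L 0, ENNReal.ofReal (g x * f₂ x) with hI₂
  have hc0 : 0 ≤ (2 * Real.pi / L) ^ 2 := sq_nonneg _
  have hle : ENNReal.ofReal ((2 * Real.pi / L) ^ 2) * (ENNReal.ofReal L * I₁) ≤
      ENNReal.ofReal L * I₂ := by
    rw [← key₁, ← key₂, ← lintegral_const_mul' _ _ ENNReal.ofReal_ne_top]
    refine lintegral_mono fun x => ?_
    rw [← ENNReal.ofReal_mul hc0]
    exact ENNReal.ofReal_le_ofReal (hAB x)
  have hL0 : ENNReal.ofReal L ≠ 0 := by simpa using hL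
  have hle' : ENNReal.ofReal ((2 * Real.pi / L) ^ 2) * I₁ ≤ I₂ := by
    rw [← mul_assoc, mul_comm (ENNReal.ofReal _) (ENNReal.ofReal L), mul_assoc] at hle
    exact (ENNReal.mul_le_mul_iff_right hL0 ENNReal.ofReal_ne_top).1 hle
  -- integrability of the two integrands on the slab
  obtain ⟨B₂, hB₂⟩ := (isCompact_closedBall (0 : EuclideanSpace ℝ (Fin 3)) (|ρ| + L)).exists_bound_of_continuousOn
    hf₂c.continuousOn
  have hG0 : 0 ≤ G := (hg0 0).trans (hgG 0)
  have hF0 : ∀ (φ : EuclideanSpace ℝ (Fin 3) → ℝ) (x : EuclideanSpace ℝ (Fin 3)),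
      ρ ≤ cylRadius x → g x * φ x = 0 := fun φ x hx => by rw [hgρ x hx, zero_mul]
  have hFB : ∀ (φ : EuclideanSpace ℝ (Fin 3) → ℝ) (B : ℝ),
      (∀ x ∈ Metric.closedBall (0 : EuclideanSpace ℝ (Fin 3)) (|ρ| + L), ‖φ x‖ ≤ B) →
      ∀ x : EuclideanSpace ℝ (Fin 3), ‖x‖ ≤ |ρ| + L → ‖g x * φ x‖ ≤ G * B := by
    intro φ B hB x hx
    rw [norm_mul, Real.norm_of_nonneg (hg0 x)]
    exact mul_le_mul (hgG x) (hB x (mem_closedBall_zero_iff.2 hx)) (norm_nonneg _) hG0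
  have hm₁ : AEStronglyMeasurable (fun x => g x * f₁ x) volume :=
    (hgm.mul hf₁c.measurable).aestronglyMeasurable
  have hm₂ : AEStronglyMeasurable (fun x => g x * f₂ x) volume :=
    (hgm.mul hf₂c.measurable).aestronglyMeasurable
  have hint₂ : IntegrableOn (fun x => g x * f₂ x) (zSlab L 0) volume :=
    integrableOn_zSlab_of_bound hL hm₂ (hF0 f₂) (hFB f₂ B₂ hB₂)
  -- back to Bochner integrals
  have hnn₁ : 0 ≤ᵐ[volume.restrict (zSlab L 0)] fun x => g x * f₁ x :=
    Eventually.of_forall fun x => mul_nonneg (hg0 x) (sq_nonneg _)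
  have hnn₂ : 0 ≤ᵐ[volume.restrict (zSlab L 0)] fun x => g x * f₂ x :=
    Eventually.of_forall fun x => mul_nonneg (hg0 x) (sq_nonneg _)
  have e₁ : ∫ x in zSlab L 0, g x * f x ^ 2 = I₁.toReal :=
    integral_eq_lintegral_of_nonneg_ae hnn₁ hm₁.restrict
  have e₂ : ∫ x in zSlab L 0, g x * (fderiv ℝ f x eZ) ^ 2 = I₂.toReal :=
    integral_eq_lintegral_of_nonneg_ae hnn₂ hm₂.restrict
  have hI₂fin : I₂ ≠ ⊤ := by
    have h := hint₂.2
    rw [hasFiniteIntegral_iff_enorm] at h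
    exact (lt_of_le_of_lt (lintegral_ofReal_le_lintegral_enorm _) h).ne
  rw [e₁, e₂, ← ENNReal.toReal_ofReal hc0, ← ENNReal.toReal_mul]
  exact ENNReal.toReal_mono hI₂fin hle'

end Summit.NavierStokesRegularity.NavierStokesRegularity.Theorems.ScenarioCensus.HelicalSlab

end
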